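import Literature.MathematicalPhysics.QuantumLattice.LiebFluxPhaseRP
import Literature.MathematicalPhysics.QuantumLattice.LiebFluxPhaseProofs
import Literature.MathematicalPhysics.QuantumLattice.FermionTorusCutPlane
import HarnessLib

/-!
# Lieb's reflection-positivity inequality for the Peierls–Hubbard torus in any dimension,
# with bond-dependent hopping through the cut (Lieb 1994, Lemma; Lieb–Nachtergaele 1995, Lemma 3.1)

E. H. Lieb, *Flux phase of the half-filled band*, PRL **73** (1994) 2158, Lemma (reflection
positivity), eq. (6): `Z(H_L, H_R)² ≤ Z(H_L, Θ(H_L)) Z(Θ(H_R), H_R)` for the half-filled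
Peierls–Hubbard Hamiltonian `H = -Σ_σ Σ_{x∼y} t^σ_{xy} c†_{xσ}c_{yσ} + U Σ_x (n_{x↑}-½)(n_{x↓}-½)`
cut by a hyperplane `P` not containing sites, "in the gauge `t_{lr} = |t_{lr}| ≥ 0`" for the bonds
`{l, r}` through `P` (p. 3). The tree's `LiebFluxPhaseRP.lean` proves it
(`LiebRP.partitionFn_sq_le_reflected`) for the square torus `(ℤ/Lℤ)²` and ONE real amplitude
`t ≥ 0` on all cut bonds. This file is the same proof (split homomorphism `Φ` of
`LiebFluxPhaseSplit`, antilinear `Θ = thetaMatrix` of `LiebFluxPhaseTheta`, antilinear DLS trace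
inequality `Matrix.norm_trace_exp_kroneckerSum_le_antiConj` of `LiebFluxPhaseDLS`) in the
geometry of `FermionTorusCutPlane.lean`:

* the torus `(ℤ/Lℤ)^{d+1}` of ANY dimension `d + 1 ≥ 1` (`L` even, `L ≥ 4`), cut perpendicular to
  coordinate `0` — in particular the RING `d + 1 = 1` of Lieb–Nachtergaele, Phys. Rev. B **51**
  (1995) 4777, §3, whose Lemma 3.1 (`RPineq`) is this inequality;
* BOND- AND SPIN-DEPENDENT nonnegative amplitudes `t^σ_{l, Rl} = tc σ l ≥ 0` through the cut
  (Lieb–Nachtergaele's two cut bonds `t_{L/2}, t_L ≥ 0` are different in general), arbitrary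
  Hermitian complex amplitudes elsewhere, any real `U`.

Contents (namespace `LiebCutRP`, mirroring `LiebRP`): `reflAmpl`, `thetaT_conj_leftHamiltonian`
(`Θ(H_L(T)) = H_R(T')`, `T' σ x y = -(T σ (R y) (R x))^*`, Lieb's eq. (4)), `crossTerm_eq`,
the DLS families `Mfam`/`Nfam` (`√(β tc) c†P ⊗ c`, …), `splitHom_neg_smul_peierlsHubbard`
(`Φ(-βH) = A ⊗ 1 + 1 ⊗ B + Σ Mᵢ ⊗ Nᵢ`), the symmetrised amplitudes `amplLL`/`amplRR`, and

* **`partitionFn_sq_le_reflected`** — `Z_β(T)² ≤ Z_β(amplLL T) · Z_β(amplRR T)` (`β ≥ 0`);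
* **`groundEnergy_add_le_two_mul`** — the ground-state form (over all of Fock space, Lieb's
  Remark (iii), `β → ∞`): `E₀(amplLL T) + E₀(amplRR T) ≤ 2 E₀(T)`, i.e. Lieb–Nachtergaele's
  `𝓔_L(t^l,t^m,t^r) ≥ ½(𝓔_L(t^l,t^m,θt^l) + 𝓔_L(θt^r,t^m,t^r))` for the electronic part; obtained
  from the generic `Matrix.groundEnergy_add_le_two_mul_of_partitionFn_sq_le`
  (`Z_β(A)² ≤ Z_β(B)Z_β(C)` for all `β > 0` ⇒ `E₀(B) + E₀(C) ≤ 2E₀(A)`).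

## References

* [Lieb1994] E. H. Lieb, Phys. Rev. Lett. 73 (1994) 2158–2161, Lemma (eq. (6)) and its proof,
  eq. (4), Remark (iii) (`β = ∞`), p. 2 ("any dimension").
* [LiebNachtergaele1995] E. H. Lieb, B. Nachtergaele, Phys. Rev. B 51 (1995) 4777
  (= arXiv:cond-mat/9410100), §3, Lemma 3.1 (`RPineq`) and its proof.
* [DLS1978] F. J. Dyson, E. H. Lieb, B. Simon, J. Stat. Phys. 18 (1978) 335, Lemma 4.1.
-/

noncomputable section

/-! ### From `Z(A)² ≤ Z(B) Z(C)` to `E₀(B) + E₀(C) ≤ 2 E₀(A)` -/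

namespace Matrix

open Literature.MathematicalPhysics.QuantumLattice

variable {m : Type*} [Fintype m] [DecidableEq m] [Nonempty m]

/-- **The `β → ∞` transfer of a reflection-positivity inequality for partition functions**: if
`(Re Z_β(A))² ≤ Re Z_β(B) · Re Z_β(C)` for all `β > 0` (Hermitian `A, B, C` on the same space),
then `E₀(B) + E₀(C) ≤ 2 E₀(A)` — keep the ground-state term on the left, bound each factor on the
right by `D e^{-βE₀}`, take logarithms and let `β → ∞` ([Lieb1994] Remark (iii): "`β = ∞`";
[LiebNachtergaele1995] Lemma 3.1 is stated directly for the lowest eigenvalue).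
[cite: Lieb1994, Remark (iii)] [cite: LiebNachtergaele1995, Lemma 3.1] -/
theorem groundEnergy_add_le_two_mul_of_partitionFn_sq_le {A B C : Matrix m m ℂ}
    (hA : A.IsHermitian) (hB : B.IsHermitian) (hC : C.IsHermitian)
    (hZ : ∀ β : ℝ, 0 < β → (A.partitionFn β).re ^ 2 ≤ (B.partitionFn β).re * (C.partitionFn β).re) :
    B.groundEnergy + C.groundEnergy ≤ 2 * A.groundEnergy := by
  by_contra hlt
  rw [not_le] at hlt
  set δ : ℝ := B.groundEnergy + C.groundEnergy - 2 * A.groundEnergy with hδ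
  have hδpos : 0 < δ := by rw [hδ]; linarith
  have hD : (1 : ℝ) ≤ Fintype.card m := by exact_mod_cast Fintype.card_pos
  have hlogD : 0 ≤ Real.log (Fintype.card m) := Real.log_nonneg hD
  -- choose `β` with `β δ = 2 log D + 1`
  set β : ℝ := (2 * Real.log (Fintype.card m) + 1) / δ with hβdef
  have hβ : 0 < β := div_pos (by linarith) hδpos
  have h1 := exp_neg_mul_groundEnergy_le_partitionFn hA β
  have h2 := partitionFn_le_card_mul_exp hB hβ.le
  have h3 := partitionFn_le_card_mul_exp hC hβ.le
  have hCpos : 0 ≤ (C.partitionFn β).re := by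
    rw [hC.partitionFn_eq_ofReal, Complex.ofReal_re]; exact (hC.sum_exp_pos β).le
  have key : Real.exp (-(β * A.groundEnergy)) ^ 2 ≤
      (Fintype.card m * Real.exp (-(β * B.groundEnergy))) *
        (Fintype.card m * Real.exp (-(β * C.groundEnergy))) :=
    calc Real.exp (-(β * A.groundEnergy)) ^ 2 ≤ (A.partitionFn β).re ^ 2 :=
          pow_le_pow_left₀ (Real.exp_pos _).le h1 2
      _ ≤ (B.partitionFn β).re * (C.partitionFn β).re := hZ β hβ
      _ ≤ _ := mul_le_mul h2 h3 hCpos (by positivity)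
  have key' : Real.exp (-(β * A.groundEnergy)) ^ 2 ≤
      (Fintype.card m : ℝ) ^ 2 * Real.exp (-(β * B.groundEnergy) + -(β * C.groundEnergy)) := by
    rw [Real.exp_add]; nlinarith [key]
  have h4 := Real.log_le_log (by positivity) key'
  rw [Real.log_pow, Real.log_exp, Real.log_mul (by positivity) (Real.exp_pos _).ne', Real.log_pow,
    Real.log_exp] at h4
  -- `-2βE_A ≤ 2 log D - β(E_B + E_C)`, i.e. `β δ ≤ 2 log D`
  have h5 : β * δ ≤ 2 * Real.log (Fintype.card m) := by
    rw [hδ]; push_cast at h4; nlinarith [h4]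
  have h6 : β * δ = 2 * Real.log (Fintype.card m) + 1 := by
    rw [hβdef, div_mul_cancel₀ _ hδpos.ne']
  linarith

end Matrix

namespace Literature.MathematicalPhysics.QuantumLattice

open Matrix Finset HubbardWave0 JWSplit PeierlsSplit NormedSpace
open scoped Kronecker ComplexOrder

namespace LiebCutRP

open FermionTorus.Cut

/-- Equality of torus sites decided through the linear order (the instance path of the generic
lemmas over a linearly ordered site type; same device as `LiebRP.decEqTorus`). Used as a LOCAL
instance in this file and its importers. [folklore] -/
abbrev decEqTorus (d L : ℕ) : DecidableEq (FermionTorus (d + 1) L) :=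
  fun a b => LinearOrder.toDecidableEq a b

attribute [local instance] decEqTorus

variable {d L : ℕ} [NeZero L]

/-- The left sites of the torus `(ℤ/Lℤ)^{d+1}` (layers `0, …, L/2 - 1` of coordinate `0`).
[cite: Lieb1994, p. 2] -/
abbrev LS (d L : ℕ) : Type := {x : FermionTorus (d + 1) L // IsLeft L x}

/-- The right sites of the torus `(ℤ/Lℤ)^{d+1}`. [cite: Lieb1994, p. 2] -/
abbrev RS (d L : ℕ) : Type := {x : FermionTorus (d + 1) L // ¬IsLeft L x}

/-- The orbital reflection `ρ : Orb Λ_L ≃ Orb Λ_R`, `(x, σ) ↦ (R x, σ)`. [cite: Lieb1994, p. 3] -/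
def orbReflect (hL : Even L) : Orb (LS d L) ≃ Orb (RS d L) := Orb.mapEquiv (leftEquivRight hL)

omit [NeZero L] in
/-- `ρ (x, σ) = (R x, σ)`. [cite: Lieb1994, Lemma (proof), pp. 3–4] -/
theorem orbReflect_orb (hL : Even L) (a : LS d L) (σ : Fin 2) :
    orbReflect hL (orb a σ) = orb (leftEquivRight hL a) σ :=
  Orb.mapEquiv_orb _ a σ

/-- **Lieb's `Θ`**: the unitary `V : ℓ²(𝒫 Orb Λ_L) → ℓ²(𝒫 Orb Λ_R)` of `LiebFluxPhaseTheta.lean`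
for the orbital reflection. [cite: Lieb1994, p. 3] -/
abbrev thetaT (d : ℕ) {L : ℕ} (hL : Even L) : Matrix (Finset (Orb (RS d L))) (Finset (Orb (LS d L))) ℂ :=
  thetaMatrix (orbReflect hL)

/-- The torus graph. [folklore] -/
abbrev G (d L : ℕ) : SimpleGraph (FermionTorus (d + 1) L) := fermionTorusGraph (d + 1) L

/-! ### `Θ(H_L) = H_R(T')` -/

/-- The amplitudes of `Θ(K_L) = -R(K_L)` on the right half: `T' σ x y = -(T σ (R y) (R x))^*`
[Lieb1994, eq. (4): `τ K(T) τ⁻¹ = K(-T^*)`, composed with `R` and `*`]. [cite: Lieb1994, eq. (4)] -/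
def reflAmpl (T : Fin 2 → FermionTorus (d + 1) L → FermionTorus (d + 1) L → ℂ) :
    Fin 2 → FermionTorus (d + 1) L → FermionTorus (d + 1) L → ℂ :=
  fun σ x y => -star (T σ (reflect y) (reflect x))

omit [NeZero L] in
/-- Unfolding lemma. [cite: Lieb1994, Lemma (proof), pp. 3–4] -/
theorem reflAmpl_apply (T : Fin 2 → FermionTorus (d + 1) L → FermionTorus (d + 1) L → ℂ) (σ : Fin 2)
    (x y : FermionTorus (d + 1) L) : reflAmpl T σ x y = -star (T σ (reflect y) (reflect x)) := rfl

omit [NeZero L] in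
/-- Conjugation by `V` of a sum. [folklore] -/
private theorem theta_conj_sum' {ι : Type*} (s : Finset ι) (hL : Even L)
    (f : ι → Matrix (Finset (Orb (LS d L))) (Finset (Orb (LS d L))) ℂ) :
    thetaT d hL * (∑ i ∈ s, f i) * (thetaT d hL)ᴴ = ∑ i ∈ s, thetaT d hL * f i * (thetaT d hL)ᴴ := by
  rw [Matrix.mul_sum, Matrix.sum_mul]

/-- **`Θ(H_L) = H_R(T')`**: conjugating the (real-conjugated) left Hamiltonian by Lieb's `V` gives
the Peierls–Hubbard Hamiltonian of the right half with amplitudes `reflAmpl T` and the same `U`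
(`Θ(K_L) = -R(K_L)`, `Θ(W⁰_L) = R(W⁰_L)`). [cite: Lieb1994, eq. (4) and p. 3] -/
theorem thetaT_conj_leftHamiltonian (hL : Even L) (h2 : 2 ≤ L)
    (T : Fin 2 → FermionTorus (d + 1) L → FermionTorus (d + 1) L → ℂ) (U : ℝ) :
    thetaT d hL * (leftHamiltonian (IsLeft L) (G d L) T U)ᴴᵀ * (thetaT d hL)ᴴ =
      rightHamiltonian (IsLeft L) (G d L) (reflAmpl T) U := by
  set e := leftEquivRight (d := d) (L := L) hL with he
  dsimp only [leftHamiltonian, rightHamiltonian]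
  rw [conjTranspose_transpose_peierlsHubbard, peierlsHubbard_def, peierlsHubbard_def, Matrix.mul_add,
    Matrix.add_mul, Matrix.mul_neg, Matrix.neg_mul, Matrix.mul_smul, Matrix.smul_mul]
  congr 2
  · -- hopping
    rw [theta_conj_sum']
    simp only [theta_conj_sum']
    rw [← e.sum_comp]
    conv_rhs => arg 2; ext b; rw [← e.sum_comp]
    rw [Finset.sum_comm]
    refine Finset.sum_congr rfl fun a _ => Finset.sum_congr rfl fun a' _ =>
      Finset.sum_congr rfl fun σ _ => ?_
    have hadj : (rightGraph (IsLeft L) (G d L)).Adj (e a) (e a') ↔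
        (leftGraph (IsLeft L) (G d L)).Adj a' a := by
      simp only [SimpleGraph.comap_adj, Function.Embedding.coe_subtype, he, leftEquivRight_apply]
      rw [adj_reflect_iff h2, (G d L).adj_comm]
    by_cases h : (leftGraph (IsLeft L) (G d L)).Adj a' a
    · rw [if_pos h, if_pos (hadj.2 h), Matrix.mul_smul, Matrix.smul_mul,
        thetaMatrix_conj_creation_mul_annihilation,
        if_neg (fun h' => h.ne (orb_eq_orb_iff.1 h').1), zero_sub, orbReflect_orb, orbReflect_orb,
        reflAmpl_apply, smul_neg, neg_smul]
      simp only [he, leftEquivRight_apply, reflect_reflect]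
    · rw [if_neg h, if_neg (fun h' => h (hadj.1 h')), Matrix.mul_zero, Matrix.zero_mul]
  · -- interaction
    rw [theta_conj_sum', ← e.sum_comp]
    refine Finset.sum_congr rfl fun a _ => ?_
    rw [thetaMatrix_conj_mul, show numberOp a (0 : Fin 2) = numberAt (orb a 0) from rfl,
      show numberOp a (1 : Fin 2) = numberAt (orb a 1) from rfl,
      thetaMatrix_conj_numberAt_sub_half, thetaMatrix_conj_numberAt_sub_half, orbReflect_orb,
      orbReflect_orb, neg_mul_neg]
    rfl

/-! ### The cross term under Lieb's gauge convention (bond-dependent cut amplitudes) -/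

/-- The hopping letters through the cut, at a boundary site `a` and its mirror image:
`(c†_{aσ} P) ⊗ c_{Ra,σ} + (P c_{aσ}) ⊗ c†_{Ra,σ}`. [cite: Lieb1994, proof of the Lemma, (ii)–(iii)] -/
abbrev cutLetters (hL : Even L) (a : LS d L) (σ : Fin 2) :
    Matrix (Finset (Orb (LS d L)) × Finset (Orb (RS d L)))
      (Finset (Orb (LS d L)) × Finset (Orb (RS d L))) ℂ :=
  hopLR (IsLeft L) a (leftEquivRight hL a) σ + hopRL (IsLeft L) a (leftEquivRight hL a) σ

/-- **The cross term in Lieb's gauge, bond-dependent amplitudes.** If the amplitude of spin `σ`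
through the cut bond `{l, R l}` is the real number `tc σ l` (both orientations), then
`crossTerm = -Σ_{l ∈ boundary} Σ_σ tc σ l · ((c†_l P) ⊗ c_{Rl} + (P c_l) ⊗ c†_{Rl})`.
[cite: Lieb1994, p. 3 ("`t_{lr} = |t_{lr}| ≥ 0`")] [cite: LiebNachtergaele1995, Lemma 3.1 (proof)] -/
theorem crossTerm_eq (hL : Even L) (h4 : 4 ≤ L)
    (T : Fin 2 → FermionTorus (d + 1) L → FermionTorus (d + 1) L → ℂ)
    (tc : Fin 2 → FermionTorus (d + 1) L → ℝ)
    (hcut : ∀ σ x, IsBoundary L x → T σ x (reflect x) = tc σ x ∧ T σ (reflect x) x = tc σ x) :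
    crossTerm (IsLeft L) (G d L) T =
      -(∑ a : LS d L, ∑ σ : Fin 2,
        if IsBoundary L a.1 then (tc σ a.1 : ℂ) • cutLetters hL a σ else 0) := by
  rw [crossTerm]
  have h1 : (∑ a : LS d L, ∑ b : RS d L, ∑ σ : Fin 2,
      if (G d L).Adj a.1 b.1 then T σ a.1 b.1 • hopLR (IsLeft L) a b σ else 0) =
      ∑ a : LS d L, ∑ σ : Fin 2,
        if IsBoundary L a.1 then (tc σ a.1 : ℂ) • hopLR (IsLeft L) a (leftEquivRight hL a) σ else 0 := by
    refine Finset.sum_congr rfl fun a _ => ?_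
    rw [Finset.sum_comm]
    refine Finset.sum_congr rfl fun σ _ => ?_
    rw [sum_right_adj_eq hL h4 a]
    split_ifs with hb
    · rw [leftEquivRight_apply, (hcut σ a.1 hb).1]
    · rfl
  have h2 : (∑ b : RS d L, ∑ a : LS d L, ∑ σ : Fin 2,
      if (G d L).Adj b.1 a.1 then T σ b.1 a.1 • hopRL (IsLeft L) a b σ else 0) =
      ∑ a : LS d L, ∑ σ : Fin 2,
        if IsBoundary L a.1 then (tc σ a.1 : ℂ) • hopRL (IsLeft L) a (leftEquivRight hL a) σ else 0 := by
    rw [Finset.sum_comm]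
    refine Finset.sum_congr rfl fun a _ => ?_
    rw [Finset.sum_comm]
    refine Finset.sum_congr rfl fun σ _ => ?_
    rw [sum_right_adj_eq' hL h4 a]
    split_ifs with hb
    · rw [leftEquivRight_apply, (hcut σ a.1 hb).2]
    · rfl
  rw [h1, h2, ← neg_add', ← Finset.sum_add_distrib]
  congr 1
  refine Finset.sum_congr rfl fun a _ => ?_
  rw [← Finset.sum_add_distrib]
  refine Finset.sum_congr rfl fun σ _ => ?_
  split_ifs
  · rw [smul_add]
  · rw [add_zero]

/-! ### The DLS families `Mᵢ`, `Nᵢ` -/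

/-- The index set of the cut letters: boundary site, spin, orientation. [folklore] -/
abbrev CutIdx (d L : ℕ) : Type := {a : LS d L // IsBoundary L a.1} × Fin 2 × Bool

/-- The weight `√(β tc σ l)` of the cut letter at `(l, σ)`. [cite: Lieb1994, proof of the Lemma] -/
def cutWeight (β : ℝ) (tc : Fin 2 → FermionTorus (d + 1) L → ℝ) (i : CutIdx d L) : ℝ :=
  Real.sqrt (β * tc i.2.1 i.1.1.1)

/-- The left factors `Mᵢ ∈ {√(β tc) c†_{aσ} P, √(β tc) P c_{aσ}}`.
[cite: Lieb1994, proof of the Lemma, (ii)–(iii)] -/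
def Mfam (β : ℝ) (tc : Fin 2 → FermionTorus (d + 1) L → ℝ) (i : CutIdx d L) :
    Matrix (Finset (Orb (LS d L))) (Finset (Orb (LS d L))) ℂ :=
  bif i.2.2 then (cutWeight β tc i : ℂ) • (creation (orb i.1.1 i.2.1) * parityOp)
  else (cutWeight β tc i : ℂ) • (parityOp * annihilation (orb i.1.1 i.2.1))

/-- The right factors `Nᵢ ∈ {√(β tc) c_{Ra,σ}, √(β tc) c†_{Ra,σ}}`.
[cite: Lieb1994, proof of the Lemma, (ii)–(iii)] -/
def Nfam (hL : Even L) (β : ℝ) (tc : Fin 2 → FermionTorus (d + 1) L → ℝ) (i : CutIdx d L) :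
    Matrix (Finset (Orb (RS d L))) (Finset (Orb (RS d L))) ℂ :=
  bif i.2.2 then (cutWeight β tc i : ℂ) • annihilation (orb (leftEquivRight hL i.1.1) i.2.1)
  else (cutWeight β tc i : ℂ) • creation (orb (leftEquivRight hL i.1.1) i.2.1)

omit [NeZero L] in
/-- **`Nᵢ = J_V(Mᵢ)`**: the cut hopping is a sum of terms `A_L ⊗ Θ(A_L)`
(`θ(c_l) = c†_r`). [cite: Lieb1994, p. 3 and proof of the Lemma] -/
theorem antiConj_thetaT_Mfam (hL : Even L) (β : ℝ) (tc : Fin 2 → FermionTorus (d + 1) L → ℝ)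
    (i : CutIdx d L) : antiConj (thetaT d hL) (Mfam β tc i) = Nfam hL β tc i := by
  obtain ⟨a, σ, b⟩ := i
  cases b
  · simp only [Mfam, Nfam, cond_false]
    rw [antiConj_ofReal_smul, antiConj_def, LiebRP.parityOp_mul_annihilation_real,
      thetaMatrix_conj_parityOp_mul_annihilation, orbReflect_orb]
  · simp only [Mfam, Nfam, cond_true]
    rw [antiConj_ofReal_smul, antiConj_def, LiebRP.creation_mul_parityOp_real,
      thetaMatrix_conj_creation_mul_parityOp, orbReflect_orb]

omit [NeZero L] in
/-- **`Σᵢ Mᵢ ⊗ Nᵢ` is the cut hopping**: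
`Σᵢ Mᵢ ⊗ Nᵢ = Σ_{a ∈ boundary, σ} β tc σ a · ((c†_a P) ⊗ c_{Ra} + (P c_a) ⊗ c†_{Ra})`.
[cite: Lieb1994, proof of the Lemma] -/
theorem sum_Mfam_kronecker_Nfam (hL : Even L) {β : ℝ} {tc : Fin 2 → FermionTorus (d + 1) L → ℝ}
    (hβt : ∀ σ x, IsBoundary L x → 0 ≤ β * tc σ x) :
    ∑ i : CutIdx d L, Mfam β tc i ⊗ₖ Nfam hL β tc i =
      ∑ a : LS d L, ∑ σ : Fin 2,
        if IsBoundary L a.1 then ((β * tc σ a.1 : ℝ) : ℂ) • cutLetters hL a σ else 0 := by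
  -- the right-hand side as an indicator sum over the left sites
  have hR : (∑ a : LS d L, ∑ σ : Fin 2,
      (if IsBoundary L a.1 then ((β * tc σ a.1 : ℝ) : ℂ) • cutLetters hL a σ else 0)) =
      ∑ a : LS d L, if IsBoundary L a.1 then ∑ σ : Fin 2, ((β * tc σ a.1 : ℝ) : ℂ) • cutLetters hL a σ
        else 0 := by
    refine Finset.sum_congr rfl fun a _ => ?_
    split_ifs
    · rfl
    · simp
  -- the left-hand side as a sum over the boundary sites
  have hLft : ∑ i : CutIdx d L, Mfam β tc i ⊗ₖ Nfam hL β tc i =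
      ∑ a' : {a : LS d L // IsBoundary L a.1}, ∑ σ : Fin 2,
        ((β * tc σ a'.1.1 : ℝ) : ℂ) • cutLetters hL a'.1 σ := by
    rw [Fintype.sum_prod_type]
    refine Finset.sum_congr rfl fun a' _ => ?_
    rw [Fintype.sum_prod_type]
    refine Finset.sum_congr rfl fun σ _ => ?_
    rw [Fintype.sum_bool]
    have hr : ((cutWeight β tc (a', σ, true) : ℂ)) * (cutWeight β tc (a', σ, true) : ℂ) =
        ((β * tc σ a'.1.1 : ℝ) : ℂ) := by
      rw [← Complex.ofReal_mul, cutWeight, Real.mul_self_sqrt (hβt σ a'.1.1 a'.2)]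
    have hr' : ((cutWeight β tc (a', σ, false) : ℂ)) * (cutWeight β tc (a', σ, false) : ℂ) =
        ((β * tc σ a'.1.1 : ℝ) : ℂ) := by
      rw [← Complex.ofReal_mul, cutWeight, Real.mul_self_sqrt (hβt σ a'.1.1 a'.2)]
    simp only [Mfam, Nfam, cond_true, cond_false]
    rw [smul_kronecker_smul, smul_kronecker_smul, hr, hr', ← smul_add]
  rw [hLft, hR, ← Finset.sum_filter]
  exact (Finset.sum_subtype (univ.filter fun a : LS d L => IsBoundary L a.1) (fun a => by simp)
    (fun a : LS d L => ∑ σ : Fin 2, ((β * tc σ a.1 : ℝ) : ℂ) • cutLetters hL a σ)).symm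

/-! ### The decomposition of `-βH(T)` along the cut -/

/-- **Symmetrised amplitudes, left kept**: `T` on the left half and through the cut, `Θ(K_L)` on the
right half, `t'_{xy} = -(t_{R y, R x})^* = -t_{R x, R y}` for Hermitian `t` — Lieb–Nachtergaele's
`(t^l, t^m, θt^l)` (up to the gauge that makes the right amplitudes positive again, available iff
`L ≡ 2 (mod 4)` on the ring). [cite: Lieb1994, eq. (4), Theorem] [cite: LiebNachtergaele1995, Lemma 3.1] -/
def amplLL (T : Fin 2 → FermionTorus (d + 1) L → FermionTorus (d + 1) L → ℂ) :
    Fin 2 → FermionTorus (d + 1) L → FermionTorus (d + 1) L → ℂ :=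
  fun σ x y => if ¬IsLeft L x ∧ ¬IsLeft L y then -star (T σ (reflect y) (reflect x)) else T σ x y

/-- **Symmetrised amplitudes, right kept**: `T` on the right half and through the cut, `Θ(K_R)` on
the left half — Lieb–Nachtergaele's `(θt^r, t^m, t^r)`. [cite: Lieb1994, eq. (4), Theorem] [cite: LiebNachtergaele1995, Lemma 3.1] -/
def amplRR (T : Fin 2 → FermionTorus (d + 1) L → FermionTorus (d + 1) L → ℂ) :
    Fin 2 → FermionTorus (d + 1) L → FermionTorus (d + 1) L → ℂ :=
  fun σ x y => if IsLeft L x ∧ IsLeft L y then -star (T σ (reflect y) (reflect x)) else T σ x y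

omit [NeZero L] in
/-- Unfolding lemma. [cite: Lieb1994, Lemma (proof), pp. 3–4] -/
theorem amplLL_apply (T : Fin 2 → FermionTorus (d + 1) L → FermionTorus (d + 1) L → ℂ) (σ : Fin 2)
    (x y : FermionTorus (d + 1) L) :
    amplLL T σ x y = if ¬IsLeft L x ∧ ¬IsLeft L y then -star (T σ (reflect y) (reflect x)) else T σ x y :=
  rfl

omit [NeZero L] in
/-- Unfolding lemma. [cite: Lieb1994, Lemma (proof), pp. 3–4] -/
theorem amplRR_apply (T : Fin 2 → FermionTorus (d + 1) L → FermionTorus (d + 1) L → ℂ) (σ : Fin 2)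
    (x y : FermionTorus (d + 1) L) :
    amplRR T σ x y = if IsLeft L x ∧ IsLeft L y then -star (T σ (reflect y) (reflect x)) else T σ x y :=
  rfl

omit [NeZero L] in
/-- `amplLL T` is Hermitian if `T` is. [cite: Lieb1994, Lemma (proof), pp. 3–4] -/
theorem amplLL_herm {T : Fin 2 → FermionTorus (d + 1) L → FermionTorus (d + 1) L → ℂ}
    (hT : ∀ σ x y, T σ y x = star (T σ x y)) (σ : Fin 2) (x y : FermionTorus (d + 1) L) :
    amplLL T σ y x = star (amplLL T σ x y) := by
  rw [amplLL_apply, amplLL_apply]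
  by_cases h : ¬IsLeft L x ∧ ¬IsLeft L y
  · rw [if_pos ⟨h.2, h.1⟩, if_pos h, star_neg, star_star, hT, star_star]
  · rw [if_neg (fun h' => h ⟨h'.2, h'.1⟩), if_neg h, hT]

omit [NeZero L] in
/-- `amplRR T` is Hermitian if `T` is. [cite: Lieb1994, Lemma (proof), pp. 3–4] -/
theorem amplRR_herm {T : Fin 2 → FermionTorus (d + 1) L → FermionTorus (d + 1) L → ℂ}
    (hT : ∀ σ x y, T σ y x = star (T σ x y)) (σ : Fin 2) (x y : FermionTorus (d + 1) L) :
    amplRR T σ y x = star (amplRR T σ x y) := by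
  rw [amplRR_apply, amplRR_apply]
  by_cases h : IsLeft L x ∧ IsLeft L y
  · rw [if_pos ⟨h.2, h.1⟩, if_pos h, star_neg, star_star, hT, star_star]
  · rw [if_neg (fun h' => h ⟨h'.2, h'.1⟩), if_neg h, hT]

omit [NeZero L] in
/-- The gauge convention through the cut, both orientations, from hermiticity. [cite: Lieb1994, Lemma (proof), pp. 3–4] -/
theorem cut_both {T : Fin 2 → FermionTorus (d + 1) L → FermionTorus (d + 1) L → ℂ}
    {tc : Fin 2 → FermionTorus (d + 1) L → ℝ}
    (hT : ∀ σ x y, T σ y x = star (T σ x y)) (hcut : ∀ σ x, IsBoundary L x → T σ x (reflect x) = tc σ x)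
    (σ : Fin 2) (x : FermionTorus (d + 1) L) (hx : IsBoundary L x) :
    T σ x (reflect x) = tc σ x ∧ T σ (reflect x) x = tc σ x := by
  refine ⟨hcut σ x hx, ?_⟩
  rw [hT, hcut σ x hx, Complex.star_def, Complex.conj_ofReal]

omit [NeZero L] in
/-- `amplLL T` obeys the same gauge convention through the cut. [cite: Lieb1994, Lemma (proof), pp. 3–4] -/
theorem cut_both_amplLL (h4 : 4 ≤ L) {T : Fin 2 → FermionTorus (d + 1) L → FermionTorus (d + 1) L → ℂ}
    {tc : Fin 2 → FermionTorus (d + 1) L → ℝ} (hT : ∀ σ x y, T σ y x = star (T σ x y))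
    (hcut : ∀ σ x, IsBoundary L x → T σ x (reflect x) = tc σ x)
    (σ : Fin 2) (x : FermionTorus (d + 1) L) (hx : IsBoundary L x) :
    amplLL T σ x (reflect x) = tc σ x ∧ amplLL T σ (reflect x) x = tc σ x := by
  have hxL : IsLeft L x := hx.isLeft h4
  rw [amplLL_apply, amplLL_apply, if_neg (fun h => h.1 hxL), if_neg (fun h => h.2 hxL)]
  exact cut_both hT hcut σ x hx

omit [NeZero L] in
/-- `amplRR T` obeys the same gauge convention through the cut. [cite: Lieb1994, Lemma (proof), pp. 3–4] -/
theorem cut_both_amplRR (hL : Even L) (h4 : 4 ≤ L)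
    {T : Fin 2 → FermionTorus (d + 1) L → FermionTorus (d + 1) L → ℂ}
    {tc : Fin 2 → FermionTorus (d + 1) L → ℝ} (hT : ∀ σ x y, T σ y x = star (T σ x y))
    (hcut : ∀ σ x, IsBoundary L x → T σ x (reflect x) = tc σ x)
    (σ : Fin 2) (x : FermionTorus (d + 1) L) (hx : IsBoundary L x) :
    amplRR T σ x (reflect x) = tc σ x ∧ amplRR T σ (reflect x) x = tc σ x := by
  have hxR : ¬IsLeft L (reflect x) := hx.not_isLeft_reflect hL h4
  rw [amplRR_apply, amplRR_apply, if_neg (fun h => hxR h.2), if_neg (fun h => hxR h.1)]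
  exact cut_both hT hcut σ x hx

/-- **`Φ(-βH(T)) = A ⊗ 1 + 1 ⊗ B + Σᵢ Mᵢ ⊗ Nᵢ`** in Lieb's gauge: `A = -βH_L`, `B = -βH_R`, and the
cut hopping `-β K_int = β Σ tc ((c†_l P) ⊗ c_r + (P c_l) ⊗ c†_r)`.
[cite: Lieb1994, eq. (5) and proof of the Lemma] -/
theorem splitHom_neg_smul_peierlsHubbard (hL : Even L) (h4 : 4 ≤ L) {β : ℝ}
    {tc : Fin 2 → FermionTorus (d + 1) L → ℝ} (hβt : ∀ σ x, IsBoundary L x → 0 ≤ β * tc σ x) (U : ℝ)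
    (T : Fin 2 → FermionTorus (d + 1) L → FermionTorus (d + 1) L → ℂ)
    (hcut : ∀ σ x, IsBoundary L x → T σ x (reflect x) = tc σ x ∧ T σ (reflect x) x = tc σ x) :
    splitHom (IsLeft L) ((-(β : ℂ)) • peierlsHubbard (G d L) T U) =
      ((-(β : ℂ)) • leftHamiltonian (IsLeft L) (G d L) T U) ⊗ₖ (1 : Matrix (Finset (Orb (RS d L))) _ ℂ) +
        (1 : Matrix (Finset (Orb (LS d L))) _ ℂ) ⊗ₖ ((-(β : ℂ)) • rightHamiltonian (IsLeft L) (G d L) T U) +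
        ∑ i : CutIdx d L, Mfam β tc i ⊗ₖ Nfam hL β tc i := by
  have hs : splitHom (IsLeft L) ((-(β : ℂ)) • peierlsHubbard (G d L) T U) =
      (-(β : ℂ)) • splitHom (IsLeft L) (peierlsHubbard (G d L) T U) :=
    (splitHom (IsLeft L)).toLinearEquiv.map_smul _ _
  rw [hs, splitHom_peierlsHubbard, crossTerm_eq hL h4 T tc hcut, sum_Mfam_kronecker_Nfam hL hβt,
    smul_add, smul_add, smul_kronecker, kronecker_smul]
  congr 1
  rw [smul_neg, ← neg_smul, neg_neg, Finset.smul_sum]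
  refine Finset.sum_congr rfl fun a _ => ?_
  rw [Finset.smul_sum]
  refine Finset.sum_congr rfl fun σ _ => ?_
  split_ifs
  · rw [smul_smul, Complex.ofReal_mul]
  · rw [smul_zero]

/-! ### The two halves of the symmetrised Hamiltonians -/

omit [NeZero L] in
/-- `H_L(amplLL T) = H_L(T)`. [cite: Lieb1994, Lemma (proof), pp. 3–4] -/
theorem leftHamiltonian_amplLL (T : Fin 2 → FermionTorus (d + 1) L → FermionTorus (d + 1) L → ℂ) (U : ℝ) :
    leftHamiltonian (IsLeft L) (G d L) (amplLL T) U = leftHamiltonian (IsLeft L) (G d L) T U := by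
  dsimp only [leftHamiltonian]
  refine peierlsHubbard_congr _ (fun σ a a' _ => ?_) U
  rw [amplLL_apply, if_neg (fun h => h.1 a.2)]

omit [NeZero L] in
/-- `H_R(amplRR T) = H_R(T)`. [cite: Lieb1994, Lemma (proof), pp. 3–4] -/
theorem rightHamiltonian_amplRR (T : Fin 2 → FermionTorus (d + 1) L → FermionTorus (d + 1) L → ℂ) (U : ℝ) :
    rightHamiltonian (IsLeft L) (G d L) (amplRR T) U = rightHamiltonian (IsLeft L) (G d L) T U := by
  dsimp only [rightHamiltonian]
  refine peierlsHubbard_congr _ (fun σ b b' _ => ?_) U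
  rw [amplRR_apply, if_neg (fun h => b.2 h.1)]

/-- **`H_R(amplLL T) = Θ(H_L(T))`.** [cite: Lieb1994, Theorem (p. 4): "`H_L, Θ(H_L)`"] -/
theorem rightHamiltonian_amplLL (hL : Even L) (h2 : 2 ≤ L)
    (T : Fin 2 → FermionTorus (d + 1) L → FermionTorus (d + 1) L → ℂ) (U : ℝ) :
    rightHamiltonian (IsLeft L) (G d L) (amplLL T) U =
      thetaT d hL * (leftHamiltonian (IsLeft L) (G d L) T U)ᴴᵀ * (thetaT d hL)ᴴ := by
  rw [thetaT_conj_leftHamiltonian hL h2 T U]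
  dsimp only [rightHamiltonian]
  refine peierlsHubbard_congr _ (fun σ b b' _ => ?_) U
  rw [amplLL_apply, if_pos ⟨b.2, b'.2⟩, reflAmpl_apply]

/-- **`H_R(T) = Θ(H_L(amplRR T))`.** [cite: Lieb1994, Theorem (p. 4): "`Θ(H_R), H_R`"] -/
theorem rightHamiltonian_eq_thetaT_amplRR (hL : Even L) (h2 : 2 ≤ L)
    (T : Fin 2 → FermionTorus (d + 1) L → FermionTorus (d + 1) L → ℂ) (U : ℝ) :
    rightHamiltonian (IsLeft L) (G d L) T U =
      thetaT d hL * (leftHamiltonian (IsLeft L) (G d L) (amplRR T) U)ᴴᵀ * (thetaT d hL)ᴴ := by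
  rw [thetaT_conj_leftHamiltonian hL h2 (amplRR T) U]
  dsimp only [rightHamiltonian]
  refine peierlsHubbard_congr _ (fun σ b b' _ => ?_) U
  have hb : IsLeft L (reflect b.1) := (isLeft_reflect_iff hL b.1).2 b.2
  have hb' : IsLeft L (reflect b'.1) := (isLeft_reflect_iff hL b'.1).2 b'.2
  rw [reflAmpl_apply, amplRR_apply, if_pos ⟨hb', hb⟩, star_neg, star_star, neg_neg, reflect_reflect,
    reflect_reflect]

omit [NeZero L] in
/-- `-β V X̄ Vᴴ = J_V(-β X)` for real `β`. [cite: Lieb1994, Lemma (proof), pp. 3–4] -/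
theorem neg_smul_thetaT_conj (hL : Even L) (β : ℝ) (X : Matrix (Finset (Orb (LS d L))) (Finset (Orb (LS d L))) ℂ) :
    (-(β : ℂ)) • (thetaT d hL * Xᴴᵀ * (thetaT d hL)ᴴ) = antiConj (thetaT d hL) ((-(β : ℂ)) • X) := by
  rw [antiConj_smul, antiConj_def, star_neg, Complex.star_def, Complex.conj_ofReal]

/-- **The decomposition of `-βH(amplLL T)`**: `A ⊗ 1 + 1 ⊗ J_V(A) + Σᵢ Mᵢ ⊗ J_V(Mᵢ)` — the first
comparison system of the DLS inequality. [cite: Lieb1994, Lemma, eq. (6)] -/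
theorem splitHom_neg_smul_amplLL (hL : Even L) (h4 : 4 ≤ L) {β : ℝ}
    {tc : Fin 2 → FermionTorus (d + 1) L → ℝ} (hβt : ∀ σ x, IsBoundary L x → 0 ≤ β * tc σ x) (U : ℝ)
    (T : Fin 2 → FermionTorus (d + 1) L → FermionTorus (d + 1) L → ℂ)
    (hT : ∀ σ x y, T σ y x = star (T σ x y)) (hcut : ∀ σ x, IsBoundary L x → T σ x (reflect x) = tc σ x) :
    splitHom (IsLeft L) ((-(β : ℂ)) • peierlsHubbard (G d L) (amplLL T) U) =
      ((-(β : ℂ)) • leftHamiltonian (IsLeft L) (G d L) T U) ⊗ₖ (1 : Matrix (Finset (Orb (RS d L))) _ ℂ) +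
        (1 : Matrix (Finset (Orb (LS d L))) _ ℂ) ⊗ₖ
          antiConj (thetaT d hL) ((-(β : ℂ)) • leftHamiltonian (IsLeft L) (G d L) T U) +
        ∑ i : CutIdx d L, Mfam β tc i ⊗ₖ antiConj (thetaT d hL) (Mfam β tc i) := by
  have e2 : ∑ i : CutIdx d L, Mfam β tc i ⊗ₖ Nfam hL β tc i =
      ∑ i : CutIdx d L, Mfam β tc i ⊗ₖ antiConj (thetaT d hL) (Mfam β tc i) :=
    Finset.sum_congr rfl fun i _ => by rw [antiConj_thetaT_Mfam]
  rw [splitHom_neg_smul_peierlsHubbard hL h4 hβt U (amplLL T) (cut_both_amplLL h4 hT hcut),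
    leftHamiltonian_amplLL, rightHamiltonian_amplLL hL (by omega), neg_smul_thetaT_conj, e2]

/-- **The decomposition of `-βH(amplRR T)`**: `J_{Vᵀ}(B) ⊗ 1 + 1 ⊗ B + Σᵢ J_{Vᵀ}(Nᵢ) ⊗ Nᵢ` — the
second comparison system of the DLS inequality. [cite: Lieb1994, Lemma, eq. (6)] -/
theorem splitHom_neg_smul_amplRR (hL : Even L) (h4 : 4 ≤ L) {β : ℝ}
    {tc : Fin 2 → FermionTorus (d + 1) L → ℝ} (hβt : ∀ σ x, IsBoundary L x → 0 ≤ β * tc σ x) (U : ℝ)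
    (T : Fin 2 → FermionTorus (d + 1) L → FermionTorus (d + 1) L → ℂ)
    (hT : ∀ σ x y, T σ y x = star (T σ x y)) (hcut : ∀ σ x, IsBoundary L x → T σ x (reflect x) = tc σ x) :
    splitHom (IsLeft L) ((-(β : ℂ)) • peierlsHubbard (G d L) (amplRR T) U) =
      antiConj (thetaT d hL)ᵀ ((-(β : ℂ)) • rightHamiltonian (IsLeft L) (G d L) T U) ⊗ₖ
          (1 : Matrix (Finset (Orb (RS d L))) _ ℂ) +
        (1 : Matrix (Finset (Orb (LS d L))) _ ℂ) ⊗ₖ ((-(β : ℂ)) • rightHamiltonian (IsLeft L) (G d L) T U) +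
        ∑ i : CutIdx d L, antiConj (thetaT d hL)ᵀ (Nfam hL β tc i) ⊗ₖ Nfam hL β tc i := by
  have hV : (thetaT d hL)ᴴ * thetaT d hL = 1 := conjTranspose_thetaMatrix_mul_self _
  have e4 : ∑ i : CutIdx d L, Mfam β tc i ⊗ₖ Nfam hL β tc i =
      ∑ i : CutIdx d L, antiConj (thetaT d hL)ᵀ (Nfam hL β tc i) ⊗ₖ Nfam hL β tc i :=
    Finset.sum_congr rfl fun i _ => by rw [← antiConj_thetaT_Mfam hL, antiConj_transpose_antiConj hV]
  have e3 : (-(β : ℂ)) • leftHamiltonian (IsLeft L) (G d L) (amplRR T) U =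
      antiConj (thetaT d hL)ᵀ ((-(β : ℂ)) • rightHamiltonian (IsLeft L) (G d L) T U) := by
    rw [rightHamiltonian_eq_thetaT_amplRR hL (by omega) T U, neg_smul_thetaT_conj,
      antiConj_transpose_antiConj hV]
  rw [splitHom_neg_smul_peierlsHubbard hL h4 hβt U (amplRR T) (cut_both_amplRR hL h4 hT hcut),
    rightHamiltonian_amplRR, e3, e4]

/-! ### Lieb's reflection-positivity inequality -/

/-- **Lieb's Lemma (reflection positivity), eq. (6) / Lieb–Nachtergaele's Lemma 3.1, for the
partition function**, on the even torus `(ℤ/Lℤ)^{d+1}` (`L ≥ 4`, any `d`, any real `U`, `β ≥ 0`),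
for Hermitian hopping amplitudes `T` that are real and nonnegative, `tc σ l ≥ 0`, on the bonds
`{l, R l}` through the cutting plane (bond and spin dependent — Lieb's gauge convention):
`Z(H_L,H_R)² ≤ Z(H_L,Θ(H_L)) · Z(Θ(H_R),H_R)`, i.e. `Z_β(T)² ≤ Z_β(amplLL T) · Z_β(amplRR T)`.
[cite: Lieb1994, Lemma, eq. (6)] [cite: LiebNachtergaele1995, Lemma 3.1 (proof)] -/
theorem partitionFn_sq_le_reflected (hL : Even L) (h4 : 4 ≤ L) {β : ℝ} (hβ : 0 ≤ β)
    {tc : Fin 2 → FermionTorus (d + 1) L → ℝ} (htc : ∀ σ x, IsBoundary L x → 0 ≤ tc σ x)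
    (U : ℝ) (T : Fin 2 → FermionTorus (d + 1) L → FermionTorus (d + 1) L → ℂ)
    (hT : ∀ σ x y, T σ y x = star (T σ x y)) (hcut : ∀ σ x, IsBoundary L x → T σ x (reflect x) = tc σ x) :
    ((peierlsHubbard (G d L) T U).partitionFn β).re ^ 2 ≤
      ((peierlsHubbard (G d L) (amplLL T) U).partitionFn β).re *
        ((peierlsHubbard (G d L) (amplRR T) U).partitionFn β).re := by
  have hβt : ∀ σ x, IsBoundary L x → 0 ≤ β * tc σ x := fun σ x hx => mul_nonneg hβ (htc σ x hx)
  -- unitarity of `V = Θ` and of `Vᵀ`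
  have hV : (thetaT d hL)ᴴ * thetaT d hL = 1 := conjTranspose_thetaMatrix_mul_self _
  have hV' : thetaT d hL * (thetaT d hL)ᴴ = 1 := thetaMatrix_mul_conjTranspose _
  have hW : ((thetaT d hL)ᵀ)ᴴ * (thetaT d hL)ᵀ = 1 := conjTranspose_transpose_mul_transpose hV'
  have hW' : (thetaT d hL)ᵀ * ((thetaT d hL)ᵀ)ᴴ = 1 := transpose_mul_conjTranspose_transpose hV
  -- the DLS inequality for the decomposition of `-βH(T)`, read back through `Φ`
  have hDLS := Matrix.norm_trace_exp_kroneckerSum_le_antiConj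
    ((-(β : ℂ)) • leftHamiltonian (IsLeft L) (G d L) T U)
    ((-(β : ℂ)) • rightHamiltonian (IsLeft L) (G d L) T U)
    (Mfam β tc) (Nfam hL β tc) hV hV' hW hW'
  rw [← splitHom_neg_smul_peierlsHubbard hL h4 hβt U T (cut_both hT hcut),
    ← splitHom_neg_smul_amplLL hL h4 hβt U T hT hcut, ← splitHom_neg_smul_amplRR hL h4 hβt U T hT hcut,
    ← LiebRP.partitionFn_eq_trace_exp_splitHom, ← LiebRP.partitionFn_eq_trace_exp_splitHom,
    ← LiebRP.partitionFn_eq_trace_exp_splitHom, norm_partitionFn_peierlsHubbard (G d L) T hT U β] at hDLS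
  -- square it
  have hposLL := (partitionFn_peierlsHubbard_re_pos (G d L) (amplLL T) (amplLL_herm hT) U β).le
  have hposRR := (partitionFn_peierlsHubbard_re_pos (G d L) (amplRR T) (amplRR_herm hT) U β).le
  have hpos := (partitionFn_peierlsHubbard_re_pos (G d L) T hT U β).le
  calc ((peierlsHubbard (G d L) T U).partitionFn β).re ^ 2
      ≤ (Real.sqrt ((peierlsHubbard (G d L) (amplLL T) U).partitionFn β).re *
          Real.sqrt ((peierlsHubbard (G d L) (amplRR T) U).partitionFn β).re) ^ 2 :=
        pow_le_pow_left₀ hpos hDLS 2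
    _ = ((peierlsHubbard (G d L) (amplLL T) U).partitionFn β).re *
          ((peierlsHubbard (G d L) (amplRR T) U).partitionFn β).re := by
        rw [mul_pow, Real.sq_sqrt hposLL, Real.sq_sqrt hposRR]

/-- **Lieb–Nachtergaele's Lemma 3.1 (`RPineq`) for the lowest eigenvalue / Lieb's Lemma at
`β = ∞`**: on the even torus `(ℤ/Lℤ)^{d+1}` (`L ≥ 4`; the ring for `d = 0`), for Hermitian hopping
amplitudes nonnegative real on the cut bonds and any real `U`, the ground-state energies over all
of Fock space satisfy `E₀(amplLL T) + E₀(amplRR T) ≤ 2 E₀(T)`, i.e.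
`λ₀(H(t^l,t^m,t^r)) ≥ ½(λ₀(H(t^l,t^m,θt^l)) + λ₀(H(θt^r,t^m,t^r)))`.
[cite: LiebNachtergaele1995, Lemma 3.1] [cite: Lieb1994, Lemma and Remark (iii)] -/
theorem groundEnergy_add_le_two_mul (hL : Even L) (h4 : 4 ≤ L)
    {tc : Fin 2 → FermionTorus (d + 1) L → ℝ} (htc : ∀ σ x, IsBoundary L x → 0 ≤ tc σ x)
    (U : ℝ) (T : Fin 2 → FermionTorus (d + 1) L → FermionTorus (d + 1) L → ℂ)
    (hT : ∀ σ x y, T σ y x = star (T σ x y)) (hcut : ∀ σ x, IsBoundary L x → T σ x (reflect x) = tc σ x) :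
    (peierlsHubbard (G d L) (amplLL T) U).groundEnergy +
        (peierlsHubbard (G d L) (amplRR T) U).groundEnergy ≤
      2 * (peierlsHubbard (G d L) T U).groundEnergy :=
  haveI : Nonempty (Finset (Orb (FermionTorus (d + 1) L))) := ⟨∅⟩
  Matrix.groundEnergy_add_le_two_mul_of_partitionFn_sq_le
    (peierlsHubbard_isHermitian (G d L) T hT U)
    (peierlsHubbard_isHermitian (G d L) (amplLL T) (amplLL_herm hT) U)
    (peierlsHubbard_isHermitian (G d L) (amplRR T) (amplRR_herm hT) U)
    (fun _ hβ => partitionFn_sq_le_reflected hL h4 hβ.le htc U T hT hcut)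

end LiebCutRP

end Literature.MathematicalPhysics.QuantumLattice

end
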